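import Summits.CriticalPhenomena.PercolationContinuityZ3.Theorems.PercNearOneGluingNoHeavyQuantSiblingStepResidualGroup
import Summits.CriticalPhenomena.PercolationContinuityZ3.Theorems.PercNearOneGluingNoHeavyQuantReducibleSibling
import HarnessLib

/-!
# QUANT lane R8, T-DEC: THE SIBLING STEP OWES ONLY FORESTS OF INDIVIDUALLY HULL-IRREDUCIBLE SIBLINGS — `SiblingStepResidual₃ ⟺ SiblingStep`;
# siblings with ≤ 2 relays are hull-reducible (`reducible_of_lowTop`, from lead g45's two-relay decompositions)

builds on p205010 (kernel theorem, internal audit signed; external expert review pending)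

Statement + support file (`--supports stmt-CriticalPhenomena-4575`), QUANT lane typer seat prim-quant-stmt (gen 40), rung R8 of
`run/shared/lean/prim/quant/LADDER.md`.  One `@[conjecture]` (`SiblingStepResidual₃`); theorems with standard axioms, no sorries.  Joins
`…QuantSiblingStepResidualGroup` (`SiblingStepResidual₂ ⟺ SiblingStep`, `GroupCovered`), `…QuantReducibleSibling` (`sdec_siblings_of_reducible`,
`inBlobHull_relaySib`) and lead g45's `…QuantTwoRelayDecorrelation` (`twoRelay_eq_relays`, `twoRelay_eq_mixture`, `TreeBuiltN.top_le_two_form`).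

* `blobLaw_one`, `blobLaw_two_relays`, `blobLaw_blob2` (the small blob laws by name), **`inBlobHull_twoRelay`** (the two-relay law `Y(G; a₁, a₂)` is a
  hull member at every floor below its marginals: two independent relays `g₊, g₋` in the real-rooted case, `λ·blob₂(g) + (1−λ)·relay(g)²` otherwise),
  **`reducible_of_lowTop`** (a tree-OK sibling with sub-forest top `≤ 2` has its gated law in the blob hull) — so `sdec_siblings_of_reducible` ⊇
  `sdec_siblings_of_lowTop`;
* **`@[conjecture] SiblingStepResidual₃`** — the list form of the node owing the DEC conclusion only for lists of `≥ 3` tree-OK siblings EVERY ONE OF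
  WHICH IS HULL-IRREDUCIBLE (`∀ m, ¬ InBlobHull x m s.M (gate s.ρ s.q)`), whose forest law is not a hull member, at outer gates outside the atomic /
  root-pattern / group-split regimes; **`siblingStep_iff_residual₃ : SiblingStep ↔ SiblingStepResidual₃`**; `Quant.farTreeRow_of_siblingStepResidual₃`.

HONEST STATUS: this residual is OPEN and NON-EMPTY as a class (typer g40 JR3-NEARSURE-G40 §3: `[glued R²[9/10](R 3/5), T_ε, T_ε]` with near-deterministic
`T_ε` — all three irreducible, joint law not a member, outer gates `a ≳ .70` outside the regimes; the node holds there by exact DEC LP, §5); `SiblingStep`,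
`GateStepN`, `FarTreeRow` OPEN; RATE class log\* / honest sentence unchanged.  [this work].  Nothing here is cited as a published result.  The gluing rows
served [cite: KozmaNitzan2024, Conjecture 3 (p. 15)]; product measure [cite: Grimmett1999, §1.3 p. 10].
-/

noncomputable section

open scoped BigOperators

namespace Summit.CriticalPhenomena.PercolationContinuityZ3.Theorems
namespace Quant
namespace LawDec

open Finset

/-- the sure single relay `δ₁` -/
local notation3 "δ₁" => (fun k : ℕ => if k = 1 then (1 : ℝ) else 0)
/-- the sure pair `δ₂` -/
local notation3 "δ₂" => (fun k : ℕ => if k = 2 then (1 : ℝ) else 0)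

/-! ### The small blob laws by name -/

/-- `blobLaw [(1, g)] = relay g = gate δ₁ g`. [this work] -/
theorem blobLaw_one (g : ℝ) : blobLaw [(1, g)] = gate δ₁ g := by
  funext h
  simp only [blobLaw, slice, gate_apply]
  rcases h with _ | _ | h
  · simp
  · simp
  · rw [if_neg (show h + 1 + 1 ≠ 0 by omega), if_pos (show 1 ≤ h + 1 + 1 by omega), if_neg (show h + 1 + 1 - 1 ≠ 0 by omega),
      if_neg (show h + 1 + 1 ≠ 1 by omega)]
    ring

/-- `blobLaw [(1, g₁), (1, g₂)] = relay g₁ ∗ relay g₂`. [this work] -/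
theorem blobLaw_two_relays (g₁ g₂ : ℝ) : blobLaw [(1, g₁), (1, g₂)] = lconv 1 1 (gate δ₁ g₁) (gate δ₁ g₂) := by
  have e : blobLaw ([(1, g₁)] ++ [(1, g₂)]) = lconv (blobTop [(1, g₂)]) (blobTop [(1, g₁)]) (blobLaw [(1, g₂)]) (blobLaw [(1, g₁)]) :=
    blobLaw_append _ _
  simp only [List.singleton_append, blobTop] at e
  rw [e, blobLaw_one, blobLaw_one, lconv_comm]

/-- `blobLaw [(2, g)] = gate δ₂ g` (a 2-blob). [this work] -/
theorem blobLaw_blob2 (g : ℝ) : blobLaw [(2, g)] = gate δ₂ g := by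
  funext h
  simp only [blobLaw, slice, gate_apply]
  rcases h with _ | _ | _ | h
  · simp
  · simp
  · simp
  · rw [if_neg (show h + 1 + 1 + 1 ≠ 0 by omega), if_pos (show 2 ≤ h + 1 + 1 + 1 by omega), if_neg (show h + 1 + 1 + 1 - 2 ≠ 0 by omega),
      if_neg (show h + 1 + 1 + 1 ≠ 2 by omega)]
    ring

/-! ### Two-relay laws are hull members -/

/-- **THE TWO-RELAY LAW IS A HULL MEMBER** at every floor `0 < x ≤ G·aᵢ` (lead g45's two decompositions read as blob-hull certificates): mean
`G(a₁ + a₂)`, top `2`. [this work] -/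
theorem inBlobHull_twoRelay (x G a₁ a₂ : ℝ) (hx0 : 0 < x) (hG0 : 0 < G) (hG1 : G ≤ 1) (ha₁ : a₁ ≤ 1) (ha₂ : a₂ ≤ 1)
    (hx₁ : x ≤ G * a₁) (hx₂ : x ≤ G * a₂) :
    InBlobHull x (G * (a₁ + a₂)) 2 (gate (lconv 1 1 (gate δ₁ a₁) (gate δ₁ a₂)) G) := by
  rcases le_or_gt (4 * (G * a₁ * a₂)) ((G * (a₁ + a₂)) ^ 2) with hD | hD
  · obtain ⟨gp, gm, hxm, hmp, hp1, hsum, _, hY⟩ := twoRelay_eq_relays x G a₁ a₂ hx0 hG0 hG1 ha₁ ha₂ hx₁ hx₂ hD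
    rw [hY, ← blobLaw_two_relays]
    have hm : blobMean [(1, gp), (1, gm)] = G * (a₁ + a₂) := by simp [blobMean]; linarith
    have h := inBlobHull_blobLaw x [(1, gp), (1, gm)]
      (fun p hp => by
        simp at hp
        rcases hp with rfl | rfl
        · exact ⟨hxm.trans hmp, hp1⟩
        · exact ⟨hxm, hmp.trans hp1⟩)
      (show blobTop [(1, gp), (1, gm)] ≤ 2 by simp [blobTop])
    rwa [hm] at h
  · obtain ⟨lam, g, hl0, hl1, hxg, hg1, hg2, hY⟩ := twoRelay_eq_mixture x G a₁ a₂ hx0 hG0 hG1 ha₁ ha₂ hx₁ hx₂ hD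
    rw [hY]
    have h2 := inBlobHull_blobLaw x [(2, g)] (fun p hp => by simp at hp; subst hp; exact ⟨hxg, hg1.le⟩) (show blobTop [(2, g)] ≤ 2 by simp [blobTop])
    have h11 := inBlobHull_blobLaw x [(1, g), (1, g)] (fun p hp => by simp at hp; subst hp; exact ⟨hxg, hg1.le⟩)
      (show blobTop [(1, g), (1, g)] ≤ 2 by simp [blobTop])
    have hm2 : blobMean [(2, g)] = G * (a₁ + a₂) := by simp [blobMean]; linarith
    have hm11 : blobMean [(1, g), (1, g)] = G * (a₁ + a₂) := by simp [blobMean]; linarith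
    rw [hm2, blobLaw_blob2] at h2
    rw [hm11, blobLaw_two_relays] at h11
    exact h2.mix h11 hl0 hl1

/-- **SIBLINGS WITH AT MOST TWO RELAYS ARE HULL-REDUCIBLE**: a tree-OK sibling with sub-forest top `≤ 2` has its gated law `gate s.ρ s.q` in the blob
hull at the floor `x > 0` (for some mean).  Top `0` is excluded by properness; top `1`: a relay `gate δ₁ (q·a)` (`inBlobHull_relaySib`); top `2`:
`inBlobHull_twoRelay` at gate `q·G` (`TreeBuiltN.top_le_two_form`). [this work] -/
theorem reducible_of_lowTop {x : ℝ} (hx0 : 0 < x) {s : Sib} (hs : s.TreeOK x) (hM : s.M ≤ 2) :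
    ∃ m : ℝ, InBlobHull x m s.M (gate s.ρ s.q) := by
  obtain ⟨hq0, hq1, hxq, hT, hnp⟩ := hs
  obtain ⟨h0, h1, h2⟩ := hT.top_le_two_form
  rcases (by omega : s.M = 0 ∨ s.M = 1 ∨ s.M = 2) with hM0 | hM1 | hM2
  · exact absurd (h0 hM0) (hnp 0)
  · obtain ⟨a, hxa, ha1, hρ⟩ := h1 hM1
    refine ⟨s.q * a, ?_⟩
    rw [hρ, hM1]
    exact inBlobHull_relaySib (hxq.trans (mul_le_mul_of_nonneg_left hxa hq0.le)) (by nlinarith) le_rfl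
  · obtain ⟨G, a₁, a₂, hG0, hG1, ha₁, ha₂, hx₁, hx₂, hρ⟩ := h2 hM2
    refine ⟨s.q * G * (a₁ + a₂), ?_⟩
    rw [hρ, hM2, gate_gate]
    have e₁ : x ≤ s.q * G * a₁ :=
      calc x ≤ s.q * s.x₁ := hxq
        _ ≤ s.q * (G * a₁) := mul_le_mul_of_nonneg_left hx₁ hq0.le
        _ = s.q * G * a₁ := by ring
    have e₂ : x ≤ s.q * G * a₂ :=
      calc x ≤ s.q * s.x₁ := hxq
        _ ≤ s.q * (G * a₂) := mul_le_mul_of_nonneg_left hx₂ hq0.le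
        _ = s.q * G * a₂ := by ring
    exact inBlobHull_twoRelay x (s.q * G) a₁ a₂ hx0 (mul_pos hq0 hG0) (by nlinarith) ha₁ ha₂ e₁ e₂

/-! ### The irreducible residual -/

/-- **CONJECTURE (THE SIBLING STEP NET, IRREDUCIBLE FORM; typer g40).**  The list form of `SiblingStep` with the DEC conclusion owed only for lists of
`≥ 3` tree-OK siblings EVERY ONE OF WHICH IS HULL-IRREDUCIBLE at the floor (`∀ m, ¬ InBlobHull x m s.M (gate s.ρ s.q)`; this contains 'every sibling
carries ≥ 3 relays', `reducible_of_lowTop`), whose forest law is not a hull member, at outer gates `a ∈ (0,1]` outside the atomic / root-pattern /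
group-split regimes.  Equivalent to `SiblingStep` (`siblingStep_iff_residual₃`); non-empty as a class (typer g40's JR₃ refutation family).
builds on p205010 (kernel theorem, internal audit signed; external expert review pending). [this work] [status: open] -/
@[conjecture] def SiblingStepResidual₃ : Prop :=
  ∀ (x : ℝ) (L : List Sib), 0 < x → x < 1 → (∀ s ∈ L, s.TreeOK x) → 3 ≤ L.length →
    (∀ s ∈ L, ∀ m : ℝ, ¬ InBlobHull x m s.M (gate s.ρ s.q)) →
    ¬ InBlobHull x (fmean L) (ftop L) (flaw L) →
    (∀ (x' : ℝ) (n' M' : ℕ) (μ' : ℕ → ℝ), n' < fgates L → TreeBuiltN x' n' M' μ' → SDEC x' M' μ') →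
    ∀ a : ℝ, 0 < a → a ≤ 1 → ¬ AtomicCovered x a L → ¬ RootPatternCovered x a L → ¬ GroupCovered x a L →
    ∀ j, j < ftop L → DECAt (a * x) j (ftop L) (gate (flaw L) a)

/-- **`SiblingStep ↔ SiblingStepResidual₃`.** [this work] -/
theorem siblingStep_iff_residual₃ : SiblingStep ↔ SiblingStepResidual₃ := by
  rw [siblingStep_iff_residual₂]
  constructor
  · intro h x L hx0 hx1 hL hk hirr hH hO a ha0 ha1 hA hR hG j hj
    refine h x L hx0 hx1 hL hk (fun s hs => ?_) hH hO a ha0 ha1 hA hR hG j hj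
    by_contra hlt
    obtain ⟨m, hm⟩ := reducible_of_lowTop hx0 (hL s hs) (by omega)
    exact hirr s hs m hm
  · intro h x L hx0 hx1 hL hk _ hH hO a ha0 ha1 hA hR hG j hj
    classical
    by_cases hred : ∃ s ∈ L, ∃ m : ℝ, InBlobHull x m s.M (gate s.ρ s.q)
    · exact sdec_siblings_of_reducible hx0 L hL hO hred a ha0 ha1 j hj
    · exact h x L hx0 hx1 hL hk (fun s hs m hm => hred ⟨s, hs, m, hm⟩) hH hO a ha0 ha1 hA hR hG j hj

end LawDec

/-- **`SiblingStepResidual₃ ⟹ Quant.FarTreeRow`, unconditionally.** [this work] -/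
theorem farTreeRow_of_siblingStepResidual₃ (h : LawDec.SiblingStepResidual₃) : FarTreeRow :=
  farTreeRow_of_siblingStep' (LawDec.siblingStep_iff_residual₃.2 h)

end Quant
end Summit.CriticalPhenomena.PercolationContinuityZ3.Theorems
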